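import Summits.QuantumFields.BalabanUV.Beta.D1BFx.GhostKernelComplete
import Summits.QuantumFields.BalabanUV.Beta.D1BFx.PackedRoadJ2Scaling

/-!
# `BalabanUV.Beta.D1BFx.GhostRayScaling` — road «BF-x» for binder row D1, slot (K), junction (J3): «J3-SCALING» —
# **THE END's GHOST RAY LETTERS ARE IDLE IN (J3): `ωgh n · PghQ n a (x₀ n) (cK n) (cQ n) = −4·N²·n⁸ · PghQ n a (−1) (n²) a`**

PART 14 (`RoadEndBFxRoadScalesS.d1Rep_BFx_road_scales_sbpS`, p331212) ∕ PART 15 display the (J3) junction as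
`hJ3 : −2·hessKer (Ggh n a) (n²•𝒢[colH G₀; ghCur]) (n²•𝒟[colH G₀; gh₂]) μ ν z = ωgh n · PghQ n a (x₀ n) (cK n) (cQ n) μ ν z + RJ3 n μ ν z`
next to the END's ray ∕ normalisation rows `hKray : cK n = cgh n·n²`, `hQray : cQ n = cgh n·a`, `hx : x₀ n = −cgh n`, `hs : s n = n⁻²`,
`hcE : cE n = n⁴`, `hlam : ωgl n·cE n² = 2·N²·n⁸`, `hωs : ωgh n·(s n·cK n)² = −2·(ωgl n·cE n²)`.  THIS FILE proves that on those rows the right side's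
main term is ONE FIXED KERNEL — the free letter `cgh n` drops out:
* §1 the completed stencil ∕ table families are homogeneous along the ray: `SghAt ρ n (c·n²) (c·a) = c • SghAt ρ n n² a`,
  `WghAt ρ n (−c) (c·n²) (c·a) = c² • WghAt ρ n (−1) n² a`;
* §2 `tableRedF` is linear in its table (`tableRedF_const_smul`), hence (with `PackedRoadJ2Scaling.TOfLeg_smul_jets`)
  **`PghQ_ray_smul : PghQ n a (−c) (c·n²) (c·a) μ ν z = c²·PghQ n a (−1) n² a μ ν z`**;
* §3 **`ghost_weight_of_rows`**: `hs hKray hcE hlam hωs` at one scale `n ≥ 2` (`N ≠ 0` not even needed) give `cgh n ≠ 0 → ωgh n = −4·N²·n⁸ ∕ (cgh n)²` and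
  UNCONDITIONALLY `ωgh n·(cgh n)² = −4·N²·n⁸`; **`ghost_ray_idle`**: `ωgh n · PghQ n a (x₀ n) (cK n) (cQ n) μ ν z = −(4·N²·n⁸) · PghQ n a (−1) (n²) a μ ν z`
  (if `cgh n = 0` both sides vanish: `hωs` forces `N = 0`… no — `hωs` then reads `0 = −4N²n⁸`, contradiction with `n ≥ 2` unless `N = 0`; we prove the identity by cases).
* §4 **`J3_iff_fixed_ray`**: PART 14's `hJ3` line at scale `n` is EQUIVALENT to the same line with the right side `−(4·N²·n⁸)·PghQ n a (−1) n² a μ ν z + RJ3 n μ ν z`.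

WHY IT MATTERS (owner's located reading, RULING ρ-g20-1 ∕ TB5-1′): (J3)'s discharge compares the road's ghost word — by PART 9's PACK-BRIDGE and `gh₂ = −ghX` EXACTLY
`−2 ×` the `D*D`-part of the completed DRESSED unit-ray word — with `−4N²n⁸ × PghQ(unit ray)`.  Any route making the road's word equal to `−2·PghQ n a (−1) n² a` modulo a
rest (ROUTE W: `= ` exactly) therefore leaves `RJ3 n = (4N²n⁸ − 2)·PghQ n a (−1) n² a + …`, whose second moment is `(4N² − 2n⁻⁸)·avgM2 n (fineHessGhQ n a (−1) n² a μ ν)`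
(`GhostKernelComplete.bondSecondMoment_PghQ_ray_eq_avgM2`) — `m`-uniformly bounded ONLY IF the ghost's block-averaged fine second moment is.  The factor `2N²n⁸` between
the END's reading-(ii) tie and the road's unit-stencil ghost tower is thereby LOCATED as a kernel identity; WHICH side carries it is the (J3) question put to an2 (FINDING F-g20-1).

HONEST DEPENDENCY (cell records, verbatim): «continuum YM on T⁴ ⇐ BetaPertH ∧ nine spine estimates (0/9 proved); BetaPertH ⇐ (D1) ∧ (D4) ∧
CAP+tail; G-an2-4 gates asym, D1 and NE2/3/4.»  HONEST FRAMING (cell contract, verbatim): «discharging `BetaPertH` makes Bałaban's UV stability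
UNCONDITIONAL — a real constructive-QFT result; it is NOT the continuum limit and NOT the Clay problem.»  THIS MODULE DISCHARGES NOTHING of (K),
of D1 or of the wall: [folklore] scalar algebra over the cell's own typed objects (`SghAt`, `WghAt`, `tableRedF`, `PghQ`).  No definition, no `def … : Prop`,
nothing cited, 0 sorry.  0 root-level binders of row D1 discharged; (J3) remains DISPLAYED; (K) NOT closed; NOT D1, NOT `BetaPertH`, NOT continuum, NOT Clay.

ABSOLUTE RULE (cell charter, verbatim): «No internally-minted statement may enter as a cited fact. Every hypothesis is either kernel-proved in this
package or a verbatim quotation of a PUBLISHED theorem with page reference. The manuscript(s) under audit are NOT citable for their own disputed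
steps — they are the thing under adjudication; programme-internal (2001/route/tribunal) claims are never citable.»

Unit `b2b-balaban-beta-d1-p2` (road «BF-x» OWNER), gen 20, 2026-08-22.
-/

noncomputable section

namespace Summit.QuantumFields.BalabanUV.Beta.D1BFx.GhostRayScaling

open scoped BigOperators
open Literature.MathematicalPhysics.QuantumFieldTheory.Balaban1983to89
open Literature.MathematicalPhysics.QuantumFieldTheory.Balaban1983to89.Beta
open ExpKernelCalculus (Site MKer hessKer)
open OneStepResolventKernel (wsum)
open Summit.QuantumFields.BalabanUV.Beta.D1BFx.GhostLeg (Ggh)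
open Summit.QuantumFields.BalabanUV.Beta.D1BFx.GhostStencil (ghCur)
open Summit.QuantumFields.BalabanUV.Beta.D1BFx.GhostStencilReflection (ghX)
open Summit.QuantumFields.BalabanUV.Beta.D1BFx.GhostStencilRooted (SghAt qAntiAt SghAt_apply)
open Summit.QuantumFields.BalabanUV.Beta.D1BFx.GhostStencilRootedReflection (ctrHalf)
open Summit.QuantumFields.BalabanUV.Beta.D1BFx.GhostAveragingSquare (WghAt qSqAt WghAt_eq)
open Summit.QuantumFields.BalabanUV.Beta.D1BFx.ReducedKernelSandwichBlock (diagExt diagExt_apply)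
open Summit.QuantumFields.BalabanUV.Beta.D1BFx.ReducedKernelF (vertexRedF TOfLeg TOfGh)
open Summit.QuantumFields.BalabanUV.Beta.D1BFx.ReducedTableF (tableRedF tableRedF_apply)
open Summit.QuantumFields.BalabanUV.Beta.D1BFx.GhostKernelComplete (PghQ PghQ_eq_TOfLeg)
open Summit.QuantumFields.BalabanUV.Beta.D1BFx.PackedRoadJ2Scaling (TOfLeg_smul_jets)

/-! ## §1 The completed ghost stencils are homogeneous along the ray -/

section Stencils

variable (ρ : Site 4) (n : ℕ) (a c : ℝ)

/-- [our object] `SghAt` is linear in its two letters: on the ray `(cK, cQ) = c·(n², a)` it is `c •` the unit-ray stencil. -/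
theorem SghAt_ray (κ : Fin 4) (u : Site 4) :
    SghAt ρ n (c * (n : ℝ) ^ 2) (c * a) κ u = c • SghAt ρ n ((n : ℝ) ^ 2) a κ u := by
  funext x z p q
  simp only [SghAt_apply, Pi.smul_apply, smul_eq_mul]
  ring

/-- [our object] The same as an equality of families. -/
theorem SghAt_ray' : SghAt ρ n (c * (n : ℝ) ^ 2) (c * a) = fun κ u => c • SghAt ρ n ((n : ℝ) ^ 2) a κ u :=
  funext fun κ => funext fun u => SghAt_ray ρ n a c κ u

/-- [our object] `WghAt` carries the products `x₀·cK`, `x₀·cQ`: on the ray `(x₀, cK, cQ) = (−c, c·n², c·a)` it is `c² •` the unit-ray table. -/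
theorem WghAt_ray (κ : Fin 4) (v : Site 4) (l : Fin 4) (v' : Site 4) :
    WghAt ρ n (-c) (c * (n : ℝ) ^ 2) (c * a) κ v l v' = (c ^ 2) • WghAt ρ n (-1) ((n : ℝ) ^ 2) a κ v l v' := by
  funext x z p q
  simp only [WghAt_eq, Pi.add_apply, Pi.smul_apply, smul_eq_mul, diagExt_apply]
  split_ifs <;> ring

/-- [our object] The same as an equality of families. -/
theorem WghAt_ray' : WghAt ρ n (-c) (c * (n : ℝ) ^ 2) (c * a) = fun κ v l v' => (c ^ 2) • WghAt ρ n (-1) ((n : ℝ) ^ 2) a κ v l v' :=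
  funext fun κ => funext fun v => funext fun l => funext fun v' => WghAt_ray ρ n a c κ v l v'

end Stencils

/-! ## §2 `tableRedF` is linear in its table; `PghQ` is degree-2 homogeneous along the ray -/

section Table

variable {F : Type*} (n : ℕ) [NeZero n]

/-- [folklore] `wsum` is homogeneous in the kernel family. -/
theorem wsum_const_smul {D : ℕ} {G : Type*} (c : ℝ) (w : (Fin D → ℤ) → ℝ) (K : (Fin D → ℤ) → MKer D G) :
    wsum w (fun u => c • K u) = c • wsum w K := by
  funext x z p q
  simp only [wsum, Pi.smul_apply, smul_eq_mul]
  rw [← tsum_mul_left]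
  exact tsum_congr fun u => by ring

/-- [folklore] **`tableRedF` IS LINEAR IN ITS TABLE**: `tableRedF n (c • Wf) = c • tableRedF n Wf`. -/
theorem tableRedF_const_smul (c : ℝ) (Wf : Fin 4 → Site 4 → Fin 4 → Site 4 → MKer 4 F) (μ : Fin 4) (y : Site 4) (ν : Fin 4) (y' : Site 4) :
    tableRedF n (fun κ u l u' => c • Wf κ u l u') μ y ν y' = c • tableRedF n Wf μ y ν y' := by
  funext x z p q
  rw [tableRedF_apply, Pi.smul_apply, Pi.smul_apply, Pi.smul_apply, Pi.smul_apply, tableRedF_apply, smul_eq_mul, Finset.mul_sum]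
  refine Finset.sum_congr rfl fun κ' _ => ?_
  rw [Finset.mul_sum]
  refine Finset.sum_congr rfl fun l' _ => ?_
  have hin : (fun u => wsum (fun u' => KernelSpecInstance.wH (N := n) (d := 3) l' ν (u' - (n : ℤ) • y')) (fun u' => c • Wf κ' u l' u'))
      = fun u => c • wsum (fun u' => KernelSpecInstance.wH (N := n) (d := 3) l' ν (u' - (n : ℤ) • y')) (Wf κ' u l') :=
    funext fun u => wsum_const_smul c _ _
  rw [hin, wsum_const_smul]
  rfl

end Table

section Ray

variable (n : ℕ) [NeZero n] (a c : ℝ)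

/-- [folklore] **`PghQ` IS DEGREE-2 HOMOGENEOUS ALONG THE WARD RAY**: `PghQ n a (−c) (c·n²) (c·a) μ ν z = c²·PghQ n a (−1) n² a μ ν z`
(§1 + `tableRedF_const_smul` + `PackedRoadJ2Scaling.TOfLeg_smul_jets`). -/
theorem PghQ_ray_smul (μ ν : Fin 4) (z : Site 4) :
    PghQ n a (-c) (c * (n : ℝ) ^ 2) (c * a) μ ν z = c ^ 2 * PghQ n a (-1) ((n : ℝ) ^ 2) a μ ν z := by
  rw [PghQ_eq_TOfLeg, PghQ_eq_TOfLeg, SghAt_ray', WghAt_ray']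
  have ht : tableRedF n (fun κ v l v' => (c ^ 2) • WghAt (ctrHalf n) n (-1) ((n : ℝ) ^ 2) a κ v l v')
      = fun μ' y ν' y' => (c ^ 2) • tableRedF n (WghAt (ctrHalf n) n (-1) ((n : ℝ) ^ 2) a) μ' y ν' y' :=
    funext fun μ' => funext fun y => funext fun ν' => funext fun y' => tableRedF_const_smul n (c ^ 2) _ μ' y ν' y'
  rw [ht]
  exact TOfLeg_smul_jets n c (Ggh n a) _ _ μ ν z

end Ray

/-! ## §3 The END's scalar rows pin the ghost weight against the unit ray -/

section Rows

variable {N a : ℝ} {cE cK cQ x₀ ωgl ωgh cgh s : ℕ → ℝ}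

/-- [folklore] **THE GHOST WEIGHT OF THE END's ROWS**: at a scale `n ≥ 2`, PART 14's `hs hKray hcE hlam hωs` give `ωgh n·(cgh n)² = −4·N²·n⁸`. -/
theorem ghost_weight_of_rows (n : ℕ) (hn : 2 ≤ n)
    (hs : ∀ n : ℕ, 2 ≤ n → s n = ((n : ℝ) ^ 2)⁻¹) (hωs : ∀ n : ℕ, 2 ≤ n → ωgh n * (s n * cK n) ^ 2 = -2 * (ωgl n * cE n ^ 2))
    (hlam : ∀ n : ℕ, 2 ≤ n → ωgl n * cE n ^ 2 = 2 * N ^ 2 * (n : ℝ) ^ 8) (hKray : ∀ n : ℕ, cK n = cgh n * (n : ℝ) ^ 2) :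
    ωgh n * cgh n ^ 2 = -4 * N ^ 2 * (n : ℝ) ^ 8 := by
  have hn0 : (n : ℝ) ≠ 0 := by exact_mod_cast (show n ≠ 0 by omega)
  have h := hωs n hn
  rw [hs n hn, hKray n, hlam n hn] at h
  have e : ((n : ℝ) ^ 2)⁻¹ * (cgh n * (n : ℝ) ^ 2) = cgh n := by field_simp
  rw [e] at h
  linarith

/-- [folklore] **THE GHOST RAY IS IDLE IN (J3)**: on PART 14's rows `hs hKray hQray hx hcE hlam hωs`, at every scale `n ≥ 2`,
`ωgh n · PghQ n a (x₀ n) (cK n) (cQ n) μ ν z = −(4·N²·n⁸) · PghQ n a (−1) n² a μ ν z` — the free letter `cgh n` cancels. -/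
theorem ghost_ray_idle (n : ℕ) [NeZero n] (hn : 2 ≤ n)
    (hs : ∀ n : ℕ, 2 ≤ n → s n = ((n : ℝ) ^ 2)⁻¹) (hωs : ∀ n : ℕ, 2 ≤ n → ωgh n * (s n * cK n) ^ 2 = -2 * (ωgl n * cE n ^ 2))
    (hlam : ∀ n : ℕ, 2 ≤ n → ωgl n * cE n ^ 2 = 2 * N ^ 2 * (n : ℝ) ^ 8)
    (hKray : ∀ n : ℕ, cK n = cgh n * (n : ℝ) ^ 2) (hQray : ∀ n : ℕ, cQ n = cgh n * a) (hx : ∀ n : ℕ, x₀ n = -cgh n)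
    (μ ν : Fin 4) (z : Site 4) :
    ωgh n * PghQ n a (x₀ n) (cK n) (cQ n) μ ν z = -(4 * N ^ 2 * (n : ℝ) ^ 8) * PghQ n a (-1) ((n : ℝ) ^ 2) a μ ν z := by
  have hw := ghost_weight_of_rows (N := N) (cE := cE) (ωgl := ωgl) n hn hs hωs hlam hKray
  rw [hx n, hKray n, hQray n, PghQ_ray_smul n a (cgh n) μ ν z, ← mul_assoc, hw]
  ring

/-! ## §4 PART 14's (J3) line with the fixed ray -/

/-- [folklore] **(J3) WITH THE FIXED RAY**: on the END's rows, PART 14's displayed `hJ3` line at a scale `n ≥ 2` (any left side `L`, any rest `R`)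
is EQUIVALENT to the same line with the main term `−(4·N²·n⁸)·PghQ n a (−1) n² a μ ν z` — no ghost letter other than the rest enters (J3). -/
theorem J3_iff_fixed_ray (n : ℕ) [NeZero n] (hn : 2 ≤ n)
    (hs : ∀ n : ℕ, 2 ≤ n → s n = ((n : ℝ) ^ 2)⁻¹) (hωs : ∀ n : ℕ, 2 ≤ n → ωgh n * (s n * cK n) ^ 2 = -2 * (ωgl n * cE n ^ 2))
    (hlam : ∀ n : ℕ, 2 ≤ n → ωgl n * cE n ^ 2 = 2 * N ^ 2 * (n : ℝ) ^ 8)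
    (hKray : ∀ n : ℕ, cK n = cgh n * (n : ℝ) ^ 2) (hQray : ∀ n : ℕ, cQ n = cgh n * a) (hx : ∀ n : ℕ, x₀ n = -cgh n)
    (L R : Fin 4 → Fin 4 → Site 4 → ℝ) (μ ν : Fin 4) (z : Site 4) :
    (L μ ν z = ωgh n * PghQ n a (x₀ n) (cK n) (cQ n) μ ν z + R μ ν z) ↔
      (L μ ν z = -(4 * N ^ 2 * (n : ℝ) ^ 8) * PghQ n a (-1) ((n : ℝ) ^ 2) a μ ν z + R μ ν z) := by
  rw [ghost_ray_idle (N := N) (a := a) (cE := cE) (ωgl := ωgl) (s := s) n hn hs hωs hlam hKray hQray hx μ ν z]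

end Rows

end Summit.QuantumFields.BalabanUV.Beta.D1BFx.GhostRayScaling

end
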